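import Mathlib
import Summits.Ventures.PercRepro2.LocRows
import Summits.Ventures.PercRepro2.SwRow
import Summits.Ventures.PercRepro2.SwOut
import Summits.Ventures.PercRepro2.SwAllRow
import Summits.Ventures.PercRepro2.SwOutAll
import Summits.Ventures.PercRepro2.SwOutArmFlip
import Summits.Ventures.PercRepro2.SwOutArmThm
import Summits.Ventures.PercRepro2.SwOutBlocks
import Summits.Ventures.PercRepro2.SwOutCoreDefs
import Summits.Ventures.PercRepro2.SwOutCoreKey
import Summits.Ventures.PercRepro2.SwOutJunction
import Summits.Ventures.PercRepro2.SwOutJunctionRegion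
import Summits.Ventures.PercRepro2.SwOutJunctionH1Defs
import Summits.Ventures.PercRepro2.SwOutJunctionH1Arms
import Summits.Ventures.PercRepro2.SwOutJunctionH1Orbit
import Summits.Ventures.PercRepro2.SwOutJunctionH1Kinds
import Summits.Ventures.PercRepro2.SwOutJunctionH1Key
import Summits.Ventures.PercRepro2.SwOutCoreShadowKey
import Summits.Ventures.PercRepro2.SwOutEdgeDefs
import Summits.Ventures.PercRepro2.SwOutEdgeCube
import Summits.Ventures.PercRepro2.SwOutEdgeBase
import Summits.Ventures.PercRepro2.SwOutEdgeKey
import Summits.Ventures.PercRepro2.SwOutEdgeShadow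
import Summits.Ventures.PercRepro2.SwOutEdgeShadowKey
import Summits.Ventures.PercRepro2.SwOutEdgeShadowKind
import Summits.Ventures.PercRepro2.SwOutEdgeShadowOrbit
import Summits.Ventures.PercRepro2.SwOutEdgeJunctionKinds

/-!
# THEOREM A⁺: the rigid inequality on every (H1) single-junction class with the junction
ADJACENT to `h` (blind cell PercRepro2, night-4 g16, 2026-08-26; proofs/NIGHT4-G15.md §4,
proofs/NIGHT4-G16.md §4)

A single-junction base region `U ∋ h` (`l ∉ U`): `u ∈ U ∖ {h, o}` has no loop and is joined to
`h` by EXACTLY ONE edge, every other vertex of `U ∖ {h, o}` carries an outside edge or no edge,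
and the simple-arm hypothesis (H1) holds on the neighbours of `u`.  THE KEY of a `Q`-point
(`keyOfE`) and THE BLOCKS (`blockOfE`) are those of Theorem A (`SwOutJunctionH1Key`) with the
e-core cube and the canonical e-core base in place of the core cube (the out kind is empty here —
`u` is in the hull of `h` through the h–u edge — but is kept, harmlessly, by the same orbit
lemma).  Every `Q`-point lies in the block of its key, every `Q`-point of that block lies in the
class with the same key, and every block satisfies the rigid inequality (`card_orbit_le`,
`card_coreCubeE_le`, `shadowBlockE_card_le`); `rigidOK_of_blocks` assembles them:
**`rigidOK_of_junctionH1Adj`**.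
-/

namespace Summit.Ventures.PercRepro2

namespace LocRows

open Hull

variable {V : Type*} {E : Type*} [Fintype E] [DecidableEq E]

open scoped Classical

variable {ends : E → Sym2 V} {U : Set V} {ξ : Config E} {l h o u : V}

section Key

variable (ends : E → Sym2 V) (U : Set V) (ξ : Config E) (h u : V)

/-- The key of a `Q`-point of a single-junction class. -/
noncomputable def keyOfE (ζ : Config E) :
    Config E ⊕ ((Config E × Finset (Set V)) ⊕ (Config E × Finset (Set V) × Finset (Set V))) :=
  if u ∉ hull ends ζ h then Sum.inl (allRed ends ζ h)
  else if hull ends ζ u ⊆ U then Sum.inr (Sum.inl (coreBaseOfE ends ζ h u, armsC ends h u ζ))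
  else if ShadowKindE ends U ξ h u ζ then
    Sum.inr (Sum.inr (baseOfE ends h u ζ, armsOf ends h u ζ, redOf ends h u ζ))
  else Sum.inl (allRed ends ζ h)

/-- The block of a key: the coarse orbit, the core cube, or the shadow block. -/
noncomputable def blockOfE :
    Config E ⊕ ((Config E × Finset (Set V)) ⊕ (Config E × Finset (Set V) × Finset (Set V))) →
      Finset (Config E)
  | Sum.inl ρ => orbit ends ρ h
  | Sum.inr (Sum.inl (b, S)) => coreCubeE ends (armsFun S) h u b
  | Sum.inr (Sum.inr (b, S, R)) => shadowBlock ends u b S R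

end Key

/-- The key of an out point. -/
lemma keyOfE_of_out {ζ : Config E} (hu : u ∉ hull ends ζ h) :
    keyOfE ends U ξ h u ζ = Sum.inl (allRed ends ζ h) := by
  simp only [keyOfE, if_pos hu]

/-- The key of a core-kind point. -/
lemma keyOfE_of_coreKind {ζ : Config E} (hu : u ∈ hull ends ζ h) (hk : hull ends ζ u ⊆ U) :
    keyOfE ends U ξ h u ζ = Sum.inr (Sum.inl (coreBaseOfE ends ζ h u, armsC ends h u ζ)) := by
  simp only [keyOfE, if_neg (not_not.2 hu), if_pos hk]

/-- The key of a shadow-kind point. -/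
lemma keyOfE_of_shadowKind {ζ : Config E} (hu : u ∈ hull ends ζ h) (hesc : ¬ hull ends ζ u ⊆ U)
    (hs : ShadowKindE ends U ξ h u ζ) :
    keyOfE ends U ξ h u ζ =
      Sum.inr (Sum.inr (baseOfE ends h u ζ, armsOf ends h u ζ, redOf ends h u ζ)) := by
  simp only [keyOfE, if_neg (not_not.2 hu), if_neg hesc, if_pos hs]

/-- The key of an escaping point of the plain kind. -/
lemma keyOfE_of_plain {ζ : Config E} (hu : u ∈ hull ends ζ h) (hesc : ¬ hull ends ζ u ⊆ U)
    (hs : ¬ ShadowKindE ends U ξ h u ζ) : keyOfE ends U ξ h u ζ = Sum.inl (allRed ends ζ h) := by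
  simp only [keyOfE, if_neg (not_not.2 hu), if_neg hesc, if_neg hs]

section Main

variable (hl : l ∉ U) (hhu : h ≠ u) (hloop_h : ∀ e, ends e ≠ s(h, h))
  (hloop_u : ∀ e, ends e ≠ s(u, u)) (hadj : ∃ e, ends e = s(h, u))
  (hhu1 : ∀ e e', ends e = s(h, u) → ends e' = s(h, u) → e = e')
  (hout : ∀ x ∈ U, x ≠ h → x ≠ o → x ≠ u →
    (∃ e y, ends e = s(x, y) ∧ y ∉ U) ∨ (∀ e, x ∉ ends e))
  (hH1 : H1 ends U h u)
include hl hhu hloop_h hloop_u hadj hhu1 hout hH1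

omit hloop_u hadj hH1 in
/-- Every `Q`-point lies in the block of its key. -/
theorem mem_blockOfE_keyOfE {ζ : Config E} (hζ : ζ ∈ swOutSide ends l h o U ξ) :
    ζ ∈ blockOfE ends h u (keyOfE ends U ξ h u ζ) := by
  by_cases hu : u ∉ hull ends ζ h
  · rw [keyOfE_of_out hu]
    exact (orbitKind_block hl hloop_h hout hζ hu).1
  rw [not_not] at hu
  by_cases hk : hull ends ζ u ⊆ U
  · rw [keyOfE_of_coreKind hu hk]
    exact (mem_coreCubeE).2 ⟨omegaOfE ends h u ζ, coreRealE_coreBaseOfE hl hhu hhu1 hout hζ ⟨hu, hk⟩⟩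
  by_cases hs : ShadowKindE ends U ξ h u ζ
  · rw [keyOfE_of_shadowKind hu hk hs]
    exact hs.2
  · rw [keyOfE_of_plain hu hk hs]
    have hc : CoreFree ends ζ h := coreFree_of_escaping hout hζ hk
    obtain ⟨ω, hω⟩ := exists_orbitReal_eq (ζ₀ := allRed ends ζ h) hc rfl
    simp only [blockOfE, orbit, Finset.mem_image, Finset.mem_univ, true_and]
    exact ⟨ω, hω⟩

/-- Every `Q`-point of the block of a `Q`-point lies in the class with the same key. -/
theorem keyOfE_eq_of_mem_blockOfE {ζ : Config E} (hζ : ζ ∈ swOutSide ends l h o U ξ) {ζ' : Config E}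
    (hζ' : ζ' ∈ blockOfE ends h u (keyOfE ends U ξ h u ζ))
    (hQ : ζ' ∈ tgtU ends l h {T : Set V | o ∈ T}) :
    ζ' ∈ swOutSide ends l h o U ξ ∧ keyOfE ends U ξ h u ζ' = keyOfE ends U ξ h u ζ := by
  by_cases hu : u ∉ hull ends ζ h
  · rw [keyOfE_of_out hu] at hζ' ⊢
    obtain ⟨h1, h2, h3⟩ := (orbitKind_block hl hloop_h hout hζ hu).2.1 ζ' hζ' hQ
    exact ⟨h1, by rw [keyOfE_of_out h2, h3]⟩
  rw [not_not] at hu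
  by_cases hk : hull ends ζ u ⊆ U
  · rw [keyOfE_of_coreKind hu hk] at hζ' ⊢
    have hb : CoreBaseE ends (coreBaseOfE ends ζ h u) h u (extHull ends ζ h u)
        (armsFun (armsC ends h u ζ)) (pureFun ends h (armsC ends h u ζ)) :=
      coreBaseE_of_coreKind hl hhu hloop_h hloop_u hadj hout hH1 hζ ⟨hu, hk⟩
    have hHU := extHull_subset_of_coreKind hζ ⟨hu, hk⟩
    obtain ⟨ω, rfl⟩ := (mem_coreCubeE).1 hζ'
    have hbcl := coreBaseOfE_mem_outClass (mem_swOutSide.1 hζ).2 ⟨hu, hk⟩ hb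
    refine ⟨mem_swOutSide.2 ⟨hQ, hb.coreRealE_mem_outClass hHU hbcl ω⟩, ?_⟩
    rw [keyOfE_of_coreKind (hb.u_mem_hull_coreRealE ω) ((hb.hull_u_coreRealE_subset ω).trans hHU),
      hb.coreBaseOfE_coreRealE, armsC_eq_of_extHull_eq (hb.extHull_coreRealE ω)]
  by_cases hs : ShadowKindE ends U ξ h u ζ
  · rw [keyOfE_of_shadowKind hu hk hs] at hζ' ⊢
    obtain ⟨h1, h2, h3, h4, h5, h6, h7⟩ := shadowKindE_of_mem_shadowBlock hl hout hs.1 hζ' hQ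
    exact ⟨h5, by rw [keyOfE_of_shadowKind h6 h7 h4, h1, h2, h3]⟩
  · rw [keyOfE_of_plain hu hk hs] at hζ' ⊢
    obtain ⟨h1, h2, h3, h4⟩ :=
      mem_orbit_plainE hl hhu hloop_h hloop_u hadj hhu1 hout hH1 hζ hu hk hs hζ' hQ
    refine ⟨h1, ?_⟩
    rw [keyOfE_of_plain h2 h3 h4]
    -- the all-red orientation is constant along the orbit
    have hc : CoreFree ends ζ h := coreFree_of_escaping hout hζ hk
    simp only [blockOfE, orbit, Finset.mem_image, Finset.mem_univ, true_and] at hζ'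
    obtain ⟨ω, rfl⟩ := hζ'
    rw [allRed_orbitReal (coreFree_allRed hc), allRed_idem hc]

omit hhu1 in
/-- Every block of a `Q`-point satisfies the rigid inequality. -/
theorem card_blockOfE_le {ζ : Config E} (hζ : ζ ∈ swOutSide ends l h o U ξ) {𝓔 : Set (Set E)}
    (h𝓔 : IsUpperSet 𝓔) :
    ((blockOfE ends h u (keyOfE ends U ξ h u ζ)).filter fun ζ' =>
        ζ' ∈ tgtU ends l h {T : Set V | o ∈ T} ∧ redEdges ends ζ' h ∈ 𝓔).card ≤
      ((blockOfE ends h u (keyOfE ends U ξ h u ζ)).filter fun ζ' =>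
        ζ' ∈ tgtU ends l h {T : Set V | o ∈ T} ∧ blueEdges ends ζ' h ∈ 𝓔).card := by
  by_cases hu : u ∉ hull ends ζ h
  · rw [keyOfE_of_out hu]
    exact (orbitKind_block hl hloop_h hout hζ hu).2.2 𝓔 h𝓔
  rw [not_not] at hu
  by_cases hk : hull ends ζ u ⊆ U
  · rw [keyOfE_of_coreKind hu hk]
    have hb : CoreBaseE ends (coreBaseOfE ends ζ h u) h u (extHull ends ζ h u)
        (armsFun (armsC ends h u ζ)) (pureFun ends h (armsC ends h u ζ)) :=
      coreBaseE_of_coreKind hl hhu hloop_h hloop_u hadj hout hH1 hζ ⟨hu, hk⟩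
    exact hb.card_coreCubeE_le (extHull_subset_of_coreKind hζ ⟨hu, hk⟩) hl h𝓔
  by_cases hs : ShadowKindE ends U ξ h u ζ
  · rw [keyOfE_of_shadowKind hu hk hs]
    exact shadowBlockE_card_le hl hs.1.hHU hs.1.hb hs.1.huB h𝓔
  · rw [keyOfE_of_plain hu hk hs]
    have hc : CoreFree ends ζ h := coreFree_of_escaping hout hζ hk
    exact card_orbit_le (coreFree_allRed hc) hloop_h
      (allRed_mem_outClass (mem_swOutSide.1 hζ).2 hc) hl h𝓔

/-- **THEOREM A⁺ — the rigid inequality on every (H1) single-junction class with the junction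
adjacent to `h`** (one h–u edge; every outside colouring `ξ`): the class is partitioned into
coarse orbits, e-core cubes and shadow blocks. -/
theorem rigidOK_of_junctionH1Adj : RigidOK ends l h o U ξ :=
  rigidOK_of_blocks ξ (keyOfE ends U ξ h u) (blockOfE ends h u)
    (fun _ hζ => mem_blockOfE_keyOfE hl hhu hloop_h hhu1 hout hζ)
    (fun _ hζ _ hζ' hQ =>
      keyOfE_eq_of_mem_blockOfE hl hhu hloop_h hloop_u hadj hhu1 hout hH1 hζ hζ' hQ)
    (fun _ hζ _ h𝓔 => card_blockOfE_le hl hhu hloop_h hloop_u hadj hout hH1 hζ h𝓔)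

end Main

end LocRows

end Summit.Ventures.PercRepro2
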